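import Summits.Ventures.Crystal3D.Bulk.GapCorners
import Literature.Geometry.DiscreteGeometry.KissingAngleBounds
import Mathlib.Analysis.Complex.Exponential
import Mathlib.Analysis.Real.Pi.Bounds
import HarnessLib

/-!
# Corner-row envelopes of the A-lineage angle LP in the kernel: a 13-digit bracket for
# `τ = arccos (1/3)`, the R5 rhombus rows in degrees with alp's literals, and the monotone cell
# envelopes of R-min / R-tri (`A_x(D)` antitone, `A_p(D)` monotone in `D`)

HONEST FRAMING. Part of the venture `Summits/Ventures/Crystal3D` (cell `pub-crystal3d`, phase 2;
seat p2, PROMOTION-AUDIT prep). Kernel theorems about an ADMISSIBLE fourteen-ball configuration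
`c` (`IsGapConfig c`) and elementary real analysis; nothing here asserts anything about GAP(1.26),
and no census number moves. Purpose (A-family audit dossier
`phase2/ENV-CENSUS/impla/audit-prep-g8/A-FAMILY-AUDIT-DOSSIER-engine4-g8.md` §2.2 rows R2/R4/R5,
§3 B5, §8 F-A3/F-A4): the pass-1 LP `alp.py` uses (i) the rhombus rows R5 with the outward DEGREE
literals `TAU_LO = 70.5287793`, `TAU_HI = 70.5287794`, and (ii) the R-min / R-tri corner envelopes
`α = arccos (1/3)`, `A_x(ρ)`, `A_p(ρ)` evaluated at the END POINTS of the cell `ρ ∈ [ρ_lo, ρ_hi]`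
under a monotonicity table ("`A_p` decreasing, `A_x` increasing in `ρ`", then widened `±10⁻⁹°`).
THIS file proves, at standard axioms:

* §1 **`abs_cos_sub_taylor_le`**: `|cos t − Σ_{j<k} (−1)^j t^{2j}/(2j)!| ≤ 2|t|^{2k}/(2k)!` for
  `|t| ≤ (2k+1)/2` (real part of Mathlib's `Complex.exp_bound'`); the 13-digit enclosure
  **`arccos_third_gt_d13` / `arccos_third_lt_d13`**: `1.2309594173407 < τ < 1.2309594173408`
  (twenty Taylor terms, `norm_num`), in degrees **`arccos_third_deg_bounds`**:
  `70.5287793655 < τ·180/π < 70.52877936552` (Mathlib's 20-digit `π`) — so `TAU_LO < τ° < TAU_HI`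
  and the `±10⁻⁹°`-widened `α` envelope `[70.5287793645…, 70.5287793665…]` encloses `τ°` (the
  three R5 rows EXACTLY AS CODED in degrees then follow from `Bulk/GapRhombusBounds.lean`; that
  two-line corollary `IsGapConfig.rhombus_rows_deg` is filed separately, `Bulk/GapRhombusRowsDeg.lean`,
  so that THIS file imports only long-built modules).
* §2 **`arccos_Ax_anti`**: `A_x(D) = arccos (D/(√3 √(4 − D²)))` is antitone in `D ∈ [0,2)`;
  **`arccos_Ap_mono`**: `A_p(D) = arccos ((2 − D²)/(4 − D²))` is monotone (`D = 2 cos ρ`, so in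
  `ρ`: `A_x` increasing, `A_p` decreasing — alp's table); hence on a cell
  `D_lo ≤ intruderDist c ≤ D_hi < 2` the rows hold with END-POINT constants:
  `IsGapConfig.arccos_Ax_cell_le_corner` (`A_x(D_hi) ≤ corner`),
  `IsGapConfig.arccos_Ap_cell_le_corner` (`A_p(D_lo) ≤ corner`),
  `IsGapConfig.corner_pTriangle_shell_mem` (`∈ [A_x(D_hi), A_x(D_lo)]`),
  `IsGapConfig.corner_pTriangle_hole_mem` (`∈ [A_p(D_lo), A_p(D_hi)]`).
  The END-POINT EVALUATION of `A_x, A_p` to rationals per cell remains a numeric step outside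
  Lean (ref-2 §S10.1 re-derived it with own code); only `τ` is bracketed here once and for all.

References: Flatley–Tarasov–Taylor–Theil, J. Comput. Appl. Math. 254 (2013), Lemma 6
[`FlatleyEtAl2013`]; Musin–Tarasov, DCG 48 (2012), Props. 3.6–3.8 [`MusinTarasov2012`].
-/

noncomputable section

open scoped BigOperators InnerProductSpace
open Finset Real

namespace Summit.Ventures.Crystal3D

/-! ## §1 A 13-digit kernel bracket for `τ = arccos (1/3)` -/

section CosTaylor

open Complex in
/-- The real part of the length-`2k` partial sum of `exp (t·i)` is the degree-`2k−2` Taylor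
polynomial of `cos` at `0`. [folklore] -/
theorem re_sum_range_two_mul_ofReal_mul_I (t : ℝ) (k : ℕ) :
    (∑ m ∈ range (2 * k), ((t : ℂ) * I) ^ m / (m.factorial : ℂ)).re =
      ∑ j ∈ range k, (-1 : ℝ) ^ j * t ^ (2 * j) / ((2 * j).factorial : ℝ) := by
  induction k with
  | zero => simp
  | succ k ih =>
    have h1 : ((t : ℂ) * I) ^ (2 * k) / ((2 * k).factorial : ℂ) =
        (((-1 : ℝ) ^ k * t ^ (2 * k) / ((2 * k).factorial : ℝ) : ℝ) : ℂ) := by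
      push_cast
      rw [mul_pow, pow_mul I 2 k, I_sq]; ring
    have h2 : ((t : ℂ) * I) ^ (2 * k + 1) / ((2 * k + 1).factorial : ℂ) =
        (((-1 : ℝ) ^ k * t ^ (2 * k + 1) / ((2 * k + 1).factorial : ℝ) : ℝ) : ℂ) * I := by
      push_cast
      rw [pow_succ, mul_pow, pow_mul I 2 k, I_sq]; ring
    rw [show 2 * (k + 1) = 2 * k + 1 + 1 by ring, sum_range_succ, sum_range_succ, add_re, add_re,
      ih, h1, h2, ofReal_re, re_ofReal_mul, I_re, mul_zero, add_zero, sum_range_succ]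

/-- **Taylor bracket for `cos`**: for `|t| ≤ (2k+1)/2`,
`|cos t − Σ_{j<k} (−1)^j t^{2j}/(2j)!| ≤ 2 |t|^{2k}/(2k)!` (real part of Mathlib's
`Complex.exp_bound'` at `x = t·i`, `n = 2k`). [folklore] -/
theorem abs_cos_sub_taylor_le (t : ℝ) (k : ℕ) (ht : |t| ≤ (2 * k + 1) / 2) :
    |Real.cos t - ∑ j ∈ range k, (-1 : ℝ) ^ j * t ^ (2 * j) / ((2 * j).factorial : ℝ)| ≤
      |t| ^ (2 * k) / ((2 * k).factorial : ℝ) * 2 := by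
  have hnorm : ‖(t : ℂ) * Complex.I‖ = |t| := by simp
  have hx : ‖(t : ℂ) * Complex.I‖ / ((2 * k).succ : ℕ) ≤ 1 / 2 := by
    rw [hnorm, div_le_iff₀ (by positivity)]
    push_cast; linarith
  have h := Complex.exp_bound' (x := (t : ℂ) * Complex.I) (n := 2 * k) hx
  rw [hnorm] at h
  have hre := Complex.abs_re_le_norm
    (Complex.exp ((t : ℂ) * Complex.I) -
      ∑ m ∈ range (2 * k), ((t : ℂ) * Complex.I) ^ m / (m.factorial : ℂ))
  rw [Complex.sub_re, Complex.exp_ofReal_mul_I_re, re_sum_range_two_mul_ofReal_mul_I] at hre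
  exact hre.trans h

/-- **`τ = arccos (1/3) > 1.2309594173407`** (`τ = 1.23095941734077468…`; twenty Taylor terms of
`cos` at `t = 1.2309594173407`, remainder `2 t²⁰/20! < 10⁻¹⁶`). [folklore] -/
theorem arccos_third_gt_d13 : (1.2309594173407 : ℝ) < Real.arccos (1 / 3) := by
  apply Literature.Geometry.DiscreteGeometry.lt_arccos_of_lt_cos (by norm_num)
    (by linarith [pi_gt_three]) (by norm_num)
  have h := abs_cos_sub_taylor_le (1.2309594173407 : ℝ) 10
    (by rw [abs_of_pos (by norm_num)]; norm_num)
  rw [abs_of_pos (show (0:ℝ) < 1.2309594173407 by norm_num)] at h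
  have h' := (abs_sub_le_iff.1 h).2
  simp only [sum_range_succ, sum_range_zero] at h'
  norm_num [Nat.factorial] at h'
  linarith

/-- **`τ = arccos (1/3) < 1.2309594173408`.** [folklore] -/
theorem arccos_third_lt_d13 : Real.arccos (1 / 3) < (1.2309594173408 : ℝ) := by
  apply Literature.Geometry.DiscreteGeometry.arccos_lt_of_cos_lt (by norm_num)
    (by linarith [pi_gt_three]) (by norm_num)
  have h := abs_cos_sub_taylor_le (1.2309594173408 : ℝ) 10
    (by rw [abs_of_pos (by norm_num)]; norm_num)
  rw [abs_of_pos (show (0:ℝ) < 1.2309594173408 by norm_num)] at h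
  have h' := (abs_sub_le_iff.1 h).1
  simp only [sum_range_succ, sum_range_zero] at h'
  norm_num [Nat.factorial] at h'
  linarith

/-- **`τ` in degrees: `70.5287793655 < arccos (1/3) · (180/π) < 70.52877936552`**
(`τ° = 70.5287793655093…°`; with Mathlib's twenty-digit `π` brackets). In particular alp's
literals `TAU_LO = 70.5287793 < τ° < TAU_HI = 70.5287794` and the `±10⁻⁹°` widening of the `α`
envelope of R2/R4 (`[70.5287793645…, 70.5287793665…]`) enclose `τ°`. [folklore] -/
theorem arccos_third_deg_bounds :
    (70.5287793655 : ℝ) < Real.arccos (1 / 3) * (180 / π) ∧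
      Real.arccos (1 / 3) * (180 / π) < 70.52877936552 := by
  have h1 := arccos_third_gt_d13
  have h2 := arccos_third_lt_d13
  have h3 := pi_gt_d20
  have h4 := pi_lt_d20
  rw [mul_div_assoc', lt_div_iff₀ pi_pos, div_lt_iff₀ pi_pos]
  constructor <;> nlinarith

end CosTaylor

/-! ## §2 The cell envelopes of R-min / R-tri: monotonicity of `A_x(D)` and `A_p(D)` in `D` -/

section Envelopes

open Literature.Geometry.DiscreteGeometry InnerProductGeometry

variable {c : Fin 14 → EuclideanSpace ℝ (Fin 3)}

/-- **`A_x(D) = arccos (D/(√3 √(4 − D²)))` is antitone in `D ∈ [0, 2)`** (the argument is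
increasing in `D`; in `ρ` with `D = 2 cos ρ`: `A_x` increasing in `ρ`, alp's monotonicity table
entry for `(ρ,60 | ρ)`). [folklore] -/
theorem arccos_Ax_anti {D₁ D₂ : ℝ} (h0 : 0 ≤ D₁) (h12 : D₁ ≤ D₂) (h2 : D₂ < 2) :
    Real.arccos (D₂ / (√3 * √(4 - D₂ ^ 2))) ≤ Real.arccos (D₁ / (√3 * √(4 - D₁ ^ 2))) := by
  apply Real.arccos_le_arccos
  have hs1 : 0 < √(4 - D₁ ^ 2) := Real.sqrt_pos.2 (by nlinarith)
  have hs2 : 0 < √(4 - D₂ ^ 2) := Real.sqrt_pos.2 (by nlinarith)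
  have hs3 : 0 < √3 := Real.sqrt_pos.2 (by norm_num)
  have key : D₁ * √(4 - D₂ ^ 2) ≤ D₂ * √(4 - D₁ ^ 2) := by
    apply (pow_le_pow_iff_left₀ (mul_nonneg h0 hs2.le) (mul_nonneg (h0.trans h12) hs1.le)
      two_ne_zero).1
    rw [mul_pow, mul_pow, Real.sq_sqrt (by nlinarith), Real.sq_sqrt (by nlinarith)]
    nlinarith [mul_le_mul h12 h12 h0 (h0.trans h12)]
  rw [div_le_div_iff₀ (by positivity) (by positivity)]
  calc D₁ * (√3 * √(4 - D₂ ^ 2)) = √3 * (D₁ * √(4 - D₂ ^ 2)) := by ring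
    _ ≤ √3 * (D₂ * √(4 - D₁ ^ 2)) := mul_le_mul_of_nonneg_left key hs3.le
    _ = D₂ * (√3 * √(4 - D₁ ^ 2)) := by ring

/-- **`A_p(D) = arccos ((2 − D²)/(4 − D²))` is monotone in `D ∈ [0, 2)`** (the argument
`1 − 2/(4 − D²)` is decreasing in `D`; in `ρ`: `A_p` decreasing, alp's table entry for
`(ρ,ρ | 60)`). [folklore] -/
theorem arccos_Ap_mono {D₁ D₂ : ℝ} (h0 : 0 ≤ D₁) (h12 : D₁ ≤ D₂) (h2 : D₂ < 2) :
    Real.arccos ((2 - D₁ ^ 2) / (4 - D₁ ^ 2)) ≤ Real.arccos ((2 - D₂ ^ 2) / (4 - D₂ ^ 2)) := by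
  apply Real.arccos_le_arccos
  rw [div_le_div_iff₀ (by nlinarith) (by nlinarith)]
  nlinarith [mul_le_mul h12 h12 h0 (h0.trans h12)]

/-- **Cell form of R-min at a shell ball next to the hole**: on a cell `intruderDist c ≤ D_hi < 2`,
`A_x(D_hi) ≤ corner c i j 13` for a shell ball `i` touching the shell ball `j` and the intruder
(the LP row R2 with the END-POINT constant). -/
theorem IsGapConfig.arccos_Ax_cell_le_corner (hc : IsGapConfig c) {Dhi : ℝ}
    (hhi : intruderDist c ≤ Dhi) (h2 : Dhi < 2) {i j : Fin 14} (hi0 : i ≠ 0) (hi13 : i ≠ 13)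
    (hj0 : j ≠ 0) (hj13 : j ≠ 13) (hij : dist (c i) (c j) = 1) (hi : dist (c i) (c 13) = 1) :
    Real.arccos (Dhi / (√3 * √(4 - Dhi ^ 2))) ≤ corner c i j 13 :=
  (arccos_Ax_anti (zero_le_one.trans hc.one_le_intruderDist) hhi h2).trans
    (hc.arccos_Ax_le_corner (lt_of_le_of_lt hhi h2) hi0 hi13 hj0 hj13 hij hi)

/-- **Cell form of R-min at the hole**: on a cell `0 ≤ D_lo ≤ intruderDist c < 2`,
`A_p(D_lo) ≤ corner c 13 j k` for shell balls `j ≠ k` touching the intruder. -/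
theorem IsGapConfig.arccos_Ap_cell_le_corner (hc : IsGapConfig c) {Dlo : ℝ} (h0 : 0 ≤ Dlo)
    (hlo : Dlo ≤ intruderDist c) (hD : intruderDist c < 2) {j k : Fin 14} (hj0 : j ≠ 0)
    (hj13 : j ≠ 13) (hk0 : k ≠ 0) (hk13 : k ≠ 13) (hj : dist (c j) (c 13) = 1)
    (hk : dist (c k) (c 13) = 1) (hjk : j ≠ k) :
    Real.arccos ((2 - Dlo ^ 2) / (4 - Dlo ^ 2)) ≤ corner c 13 j k :=
  (arccos_Ap_mono h0 hlo hD).trans (hc.arccos_Ap_le_corner hD hj0 hj13 hk0 hk13 hj hk hjk)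

/-- **Cell form of R-tri at a shell corner of a `p`-triangle**: on a cell
`D_lo ≤ intruderDist c ≤ D_hi < 2` (`0 ≤ D_lo`), the corner at `i` of a tight triangle `i j 13`
lies in `[A_x(D_hi), A_x(D_lo)]` (the LP's global-variable bounds of R4). -/
theorem IsGapConfig.corner_pTriangle_shell_mem (hc : IsGapConfig c) {Dlo Dhi : ℝ} (h0 : 0 ≤ Dlo)
    (hlo : Dlo ≤ intruderDist c) (hhi : intruderDist c ≤ Dhi) (h2 : Dhi < 2) {i j : Fin 14}
    (hi0 : i ≠ 0) (hi13 : i ≠ 13) (hj0 : j ≠ 0) (hj13 : j ≠ 13) (hij : dist (c i) (c j) = 1)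
    (hi : dist (c i) (c 13) = 1) (hj : dist (c j) (c 13) = 1) :
    Real.arccos (Dhi / (√3 * √(4 - Dhi ^ 2))) ≤ corner c i j 13 ∧
      corner c i j 13 ≤ Real.arccos (Dlo / (√3 * √(4 - Dlo ^ 2))) := by
  have hD : intruderDist c < 2 := lt_of_le_of_lt hhi h2
  rw [hc.corner_eq_arccos_Ax hD hi0 hi13 hj0 hj13 hij hi hj]
  exact ⟨arccos_Ax_anti (zero_le_one.trans hc.one_le_intruderDist) hhi h2,
    arccos_Ax_anti h0 hlo hD⟩

/-- **Cell form of R-tri at the hole corner of a `p`-triangle**: on a cell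
`D_lo ≤ intruderDist c ≤ D_hi < 2` (`0 ≤ D_lo`), the corner at the intruder of a tight triangle
`13 j k` lies in `[A_p(D_lo), A_p(D_hi)]`. -/
theorem IsGapConfig.corner_pTriangle_hole_mem (hc : IsGapConfig c) {Dlo Dhi : ℝ} (h0 : 0 ≤ Dlo)
    (hlo : Dlo ≤ intruderDist c) (hhi : intruderDist c ≤ Dhi) (h2 : Dhi < 2) {j k : Fin 14}
    (hj0 : j ≠ 0) (hj13 : j ≠ 13) (hk0 : k ≠ 0) (hk13 : k ≠ 13) (hj : dist (c j) (c 13) = 1)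
    (hk : dist (c k) (c 13) = 1) (hjk : dist (c j) (c k) = 1) :
    Real.arccos ((2 - Dlo ^ 2) / (4 - Dlo ^ 2)) ≤ corner c 13 j k ∧
      corner c 13 j k ≤ Real.arccos ((2 - Dhi ^ 2) / (4 - Dhi ^ 2)) := by
  have hD : intruderDist c < 2 := lt_of_le_of_lt hhi h2
  rw [hc.corner_eq_arccos_Ap hD hj0 hj13 hk0 hk13 hj hk hjk]
  exact ⟨arccos_Ap_mono h0 hlo hD,
    arccos_Ap_mono (zero_le_one.trans hc.one_le_intruderDist) hhi h2⟩

end Envelopes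

end Summit.Ventures.Crystal3D
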